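import Mathlib
import Literature.Computability.Complexity.RangeAvoidance
import Literature.Computability.Complexity.SignDegreeXor
import Summits.PneNP.PneNP.Theorems.PstarPDT
import Summits.PneNP.PneNP.Theorems.PstarFibrePolys
import Summits.PneNP.PneNP.Theorems.PstarSALevel
import Summits.PneNP.PneNP.Theorems.PstarSAClosure
import Summits.PneNP.PneNP.Theorems.PstarTyped
import Summits.PneNP.PneNP.Theorems.PstarGapLinearised
import Summits.PneNP.PneNP.Theorems.PstarGapPeeling
import Summits.PneNP.PneNP.Theorems.PstarCentreFree
import Summits.PneNP.PneNP.Theorems.PstarChordRepair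
import Summits.PneNP.PneNP.Theorems.PstarGapOneKills
import Summits.PneNP.PneNP.Theorems.PstarGapOneAndRepair
import Summits.PneNP.PneNP.Theorems.PstarGapOneAll
import Summits.PneNP.PneNP.Theorems.PstarGConstraint
import Summits.PneNP.PneNP.Theorems.PstarGSatChord
import Summits.PneNP.PneNP.Theorems.PstarGSatStructure

/-!
# The reader-graph induction: the chord case (e) (ROUND-24 item T24.17′, steps)

FRONTIER range-avoidance ladder, rung F-N3, ROUND 24 (cell `pnp-ideate`; restricted-model proof complexity — nothing here bears on
`P` versus `NP`).  Memo ROUND-24-PRESEED §13 R10(p)(e); referee AUDIT-r10p-gsat-g43 (P1, P2).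

**`chords_false`.**  In the inductive step of `GSat` (unsat assumption, non-constant constraint), suppose every `J`-private XOR slot
lies in `C` (step (a)) and every chord satisfies the conclusion of `PstarGSatStructure.chord_structure` (step (c)); then `J` has no
chord.  Proof: a chord `g₀` makes `C` free of XOR-type variables, so NO XOR slot is private; counting boundary variables
(`≤ 2` per chord, `≤ 1` per other output) against `(r,3/2)`-expansion gives `#F₁ + 3#F₀ ≤ #Ch`; three chords have pairwise disjoint
pairs which no `G`-pair can all meet, forcing `G = ∅ = C` (constant constraint); one or two chords leave `|J| ≤ 4` and the
configuration `g₁, g₂, f₁, f₂` with `f₁, f₂` sharing their non-private AND variable `d` (the `C₄`); there `PstarCentreFree.claim`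
activates `d`, two XOR flips make both chords want product `0`, and the `(0,0)`-based toggles (`bit_gval_update_and`) show
`C = ∅ = G` again (this replaces the memo's explicit evaluation, care P2).
-/

set_option linter.dupNamespace false -- `Summit.PneNP.PneNP.…`: summit = sub-problem name (D-0017 single-conjunct layout)

open Finset Literature.Computability.Complexity
open scoped symmDiff
open Summit.PneNP.PneNP.Theorems.PstarPDT (parity)
open Summit.PneNP.PneNP.Theorems.PstarFibrePolys (bit bit_injective)
open Summit.PneNP.PneNP.Theorems.PstarTyped (Typed)
open Summit.PneNP.PneNP.Theorems.PstarSALevel (varSet bdry BoundaryExpanding SimpleOverlap)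
open Summit.PneNP.PneNP.Theorems.PstarSAClosure (exists_two_private)
open Summit.PneNP.PneNP.Theorems.PstarGapLinearised (andPair)
open Summit.PneNP.PneNP.Theorems.PstarGapPeeling (not_mem_varSet_of_private eval_update_of_not_mem eval_pure eval_update_xor_slot)
open Summit.PneNP.PneNP.Theorems.PstarCentreFree (vars_mem_varSet)
open Summit.PneNP.PneNP.Theorems.PstarChordRepair (IsChord)
open Summit.PneNP.PneNP.Theorems.PstarGapOneKills (exists_other_reader and_slot_of_mem_varSet and_slot_not_mem_chord eq_of_bdry)
open Summit.PneNP.PneNP.Theorems.PstarGapOneAndRepair (eval_update_and_slot exists_slot_of_mem_varSet)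
open Summit.PneNP.PneNP.Theorems.PstarGapOneAll (gval)
open Summit.PneNP.PneNP.Theorems.PstarGConstraint
open Summit.PneNP.PneNP.Theorems.PstarGSatChord
open Summit.PneNP.PneNP.Theorems.PstarGSatStructure

namespace Summit.PneNP.PneNP.Theorems.PstarGSatChords

variable {n m : ℕ}

section Chords

variable (I : LocalMap 4 n m) (hI : I.IsPure xorAndPred) (hT : Typed I) {r : ℕ} (hB : BoundaryExpanding r I) (hS : SimpleOverlap I)
  (J G : Finset (Fin m)) (C : Finset (Fin n)) (hJr : J.card ≤ r)
  (hnc : ∃ z z' : Fin n → Bool, gval I C G z ≠ gval I C G z')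
  (hxorC : ∀ g ∈ J, ∀ s : Fin 4, s.val < 2 → I.vars g s ∈ bdry I J → I.vars g s ∈ C)
  (hstruct : ∀ g ∈ J, IsChord I J g →
    ((C.erase (I.vars g 2)).erase (I.vars g 3)) ∆ nbG I G (I.vars g 2) ∆ nbG I G (I.vars g 3) = ∅ ∧
      (G.filter fun g' => I.vars g 2 ∉ andPair I g' ∧ I.vars g 3 ∉ andPair I g') = ∅)

include hstruct hI hT hS

/-- (e1) A chord makes `C` free of XOR-type variables. -/
theorem xor_not_mem_C {g₀ : Fin m} (hg₀ : g₀ ∈ J) (hc₀ : IsChord I J g₀) (j : Fin m) (s : Fin 4) (hs : s.val < 2) :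
    I.vars j s ∉ C := by
  intro hv
  obtain ⟨hnd, -⟩ := andPairs_simple I hI hS G
  have h2 : I.vars j s ≠ I.vars g₀ 2 := fun h => hT j g₀ s 2 hs (by decide) h
  have h3 : I.vars j s ≠ I.vars g₀ 3 := fun h => hT j g₀ s 3 hs (by decide) h
  rcases mem_C_imp I J G C hstruct hg₀ hc₀ hv h2 h3 with h | h <;>
  · obtain ⟨g', -, hx, -, -⟩ := mem_nbG_and hnd h
    rcases hx with hx | hx
    · exact hT j g' s 2 hs (by decide) hx.symm
    · exact hT j g' s 3 hs (by decide) hx.symm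

include hB hJr hnc hxorC

/-- **(e) A chord is impossible** — given the `C₄` endgame `c4` (the statement of `PstarGSatC4.c4_false`, taken as a
hypothesis so that the two files are independent; the assembly `PstarGSat` supplies it). -/
theorem chords_false
    (c4 : ∀ (g₁ g₂ f₁ f₂ : Fin m), g₁ ∈ J → g₂ ∈ J → IsChord I J g₁ → IsChord I J g₂ → g₁ ≠ g₂ →
      f₁ ∈ J → f₂ ∈ J → ¬ IsChord I J f₁ → ¬ IsChord I J f₂ →
      ∀ (sa₁ sd₁ sa₂ sd₂ : Fin 4), 2 ≤ sa₁.val → 2 ≤ sd₁.val → sa₁ ≠ sd₁ → 2 ≤ sa₂.val → 2 ≤ sd₂.val → sa₂ ≠ sd₂ →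
      I.vars f₁ sa₁ ∈ bdry I J → I.vars f₂ sa₂ ∈ bdry I J → I.vars f₁ sd₁ = I.vars f₂ sd₂ →
      (∀ j ∈ J, j = g₁ ∨ j = g₂ ∨ j = f₁ ∨ j = f₂) →
      (∀ g' ∈ G, (I.vars g₁ 2 ∈ andPair I g' ∨ I.vars g₁ 3 ∈ andPair I g') ∧
        (I.vars g₂ 2 ∈ andPair I g' ∨ I.vars g₂ 3 ∈ andPair I g')) →
      (∀ v ∈ C, v = I.vars g₁ 2 ∨ v = I.vars g₁ 3 ∨ v = I.vars g₂ 2 ∨ v = I.vars g₂ 3) → False)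
    {g₀ : Fin m} (hg₀ : g₀ ∈ J) (hc₀ : IsChord I J g₀) : False := by
  classical
  obtain ⟨hnd, hdist⟩ := andPairs_simple I hI hS G
  -- private variables of chords
  have hP : ∀ {g : Fin m}, g ∈ J → IsChord I J g → ∀ s : Fin 4, 2 ≤ s.val → ∀ j ∈ J, j ≠ g → I.vars g s ∉ varSet I j := by
    intro g hg hc s hs j hj hjg
    have : s = 2 ∨ s = 3 := by fin_cases s <;> simp at hs ⊢
    rcases this with rfl | rfl
    · exact not_mem_varSet_of_private I hg hj hjg hc.1 (vars_mem_varSet I g 2)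
    · exact not_mem_varSet_of_private I hg hj hjg hc.2 (vars_mem_varSet I g 3)
  -- (e1)/(e2): no private XOR slot; every XOR slot has another reader
  have hnoX : ∀ g ∈ J, ∀ s : Fin 4, s.val < 2 → I.vars g s ∉ bdry I J := fun g hg s hs hb =>
    xor_not_mem_C I hI hT hS J G C hstruct hg₀ hc₀ g s hs (hxorC g hg s hs hb)
  -- (e3) counting: `#F₁ + 3 #F₀ ≤ #Ch`
  obtain ⟨Ch, hCh⟩ : ∃ Ch : Finset (Fin m), Ch = J.filter (fun j => IsChord I J j) := ⟨_, rfl⟩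
  obtain ⟨F₁, hF₁⟩ : ∃ F₁ : Finset (Fin m), F₁ = J.filter (fun j => ¬ IsChord I J j ∧ (I.vars j 2 ∈ bdry I J ∨ I.vars j 3 ∈ bdry I J)) :=
    ⟨_, rfl⟩
  obtain ⟨F₀, hF₀⟩ : ∃ F₀ : Finset (Fin m), F₀ = J.filter (fun j => ¬ IsChord I J j ∧ ¬ (I.vars j 2 ∈ bdry I J ∨ I.vars j 3 ∈ bdry I J)) :=
    ⟨_, rfl⟩
  have hcount : F₁.card + 3 * F₀.card ≤ Ch.card := by
    -- fibres
    have hfib_sub : ∀ j ∈ J, (bdry I J).filter (fun v => v ∈ varSet I j) ⊆ {I.vars j 2, I.vars j 3} := by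
      intro j hj v hv
      obtain ⟨hvb, hvj⟩ := mem_filter.1 hv
      obtain ⟨s, hs⟩ := exists_slot_of_mem_varSet I hvj
      rw [mem_insert, mem_singleton, ← hs]
      have hs2 : 2 ≤ s.val := by
        by_contra h
        push Not at h
        exact hnoX j hj s h (hs ▸ hvb)
      have : s = 2 ∨ s = 3 := by fin_cases s <;> simp at hs2 ⊢
      rcases this with rfl | rfl
      exacts [Or.inl rfl, Or.inr rfl]
    have hcover : bdry I J ⊆ J.biUnion (fun j => (bdry I J).filter fun v => v ∈ varSet I j) := by
      intro v hv
      have hv' := hv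
      unfold PstarSALevel.bdry at hv'
      rw [mem_filter, card_eq_one] at hv'
      obtain ⟨j, hj⟩ := hv'.2
      have hjm : j ∈ J.filter (fun i => v ∈ varSet I i) := by rw [hj]; exact mem_singleton_self j
      exact mem_biUnion.2 ⟨j, (mem_filter.1 hjm).1, mem_filter.2 ⟨hv, (mem_filter.1 hjm).2⟩⟩
    have hle : (bdry I J).card ≤ ∑ j ∈ J, ((bdry I J).filter fun v => v ∈ varSet I j).card :=
      (card_le_card hcover).trans card_biUnion_le
    have hpt : ∀ j ∈ J, ((bdry I J).filter fun v => v ∈ varSet I j).card ≤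
        (if IsChord I J j then 2 else 0) + (if ¬ IsChord I J j ∧ (I.vars j 2 ∈ bdry I J ∨ I.vars j 3 ∈ bdry I J) then 1 else 0) := by
      intro j hj
      by_cases hc : IsChord I J j
      · rw [if_pos hc, if_neg (fun h => h.1 hc), add_zero]
        exact (card_le_card (hfib_sub j hj)).trans (card_insert_le _ _ |>.trans (by rw [card_singleton]))
      · rw [if_neg hc, zero_add]
        by_cases h23 : I.vars j 2 ∈ bdry I J ∨ I.vars j 3 ∈ bdry I J
        · rw [if_pos ⟨hc, h23⟩]
          -- not both
          have hnb : ¬ (I.vars j 2 ∈ bdry I J ∧ I.vars j 3 ∈ bdry I J) := hc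
          rcases h23 with h2 | h3
          · have h3 : I.vars j 3 ∉ bdry I J := fun h => hnb ⟨h2, h⟩
            refine (card_le_card (fun v hv => ?_)).trans (card_singleton (I.vars j 2)).le
            have hv' := hfib_sub j hj hv
            rw [mem_insert, mem_singleton] at hv'
            rw [mem_singleton]
            rcases hv' with h | h
            · exact h
            · exact absurd ((mem_filter.1 hv).1) (h ▸ h3)
          · have h2 : I.vars j 2 ∉ bdry I J := fun h => hnb ⟨h, h3⟩
            refine (card_le_card (fun v hv => ?_)).trans (card_singleton (I.vars j 3)).le
            have hv' := hfib_sub j hj hv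
            rw [mem_insert, mem_singleton] at hv'
            rw [mem_singleton]
            rcases hv' with h | h
            · exact absurd ((mem_filter.1 hv).1) (h ▸ h2)
            · exact h
        · rw [if_neg (fun h => h23 h.2)]
          refine Nat.le_zero.2 (card_eq_zero.2 (eq_empty_of_forall_notMem fun v hv => ?_))
          have hv' := hfib_sub j hj hv
          rw [mem_insert, mem_singleton] at hv'
          rcases hv' with h | h
          · exact h23 (Or.inl (h ▸ (mem_filter.1 hv).1))
          · exact h23 (Or.inr (h ▸ (mem_filter.1 hv).1))
    have hsum : ∑ j ∈ J, ((bdry I J).filter fun v => v ∈ varSet I j).card ≤ 2 * Ch.card + F₁.card := by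
      refine (sum_le_sum hpt).trans (le_of_eq ?_)
      rw [sum_add_distrib, hCh, hF₁, card_filter, card_filter, mul_sum]
      congr 1
      exact sum_congr rfl fun j _ => by split_ifs <;> rfl
    have hpart : J.card = Ch.card + F₁.card + F₀.card := by
      rw [hCh, hF₁, hF₀, ← card_filter_add_card_filter_not (fun j => IsChord I J j)]
      rw [add_assoc, ← card_filter_add_card_filter_not (s := J.filter fun j => ¬ IsChord I J j)
        (fun j => I.vars j 2 ∈ bdry I J ∨ I.vars j 3 ∈ bdry I J), filter_filter, filter_filter]
    have hexp := hB J hJr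
    omega
  -- (e4) three chords: impossible
  by_cases h3 : 2 < Ch.card
  · obtain ⟨a, ha, b', hb', c, hc, hab, hac, hbc⟩ := two_lt_card.1 h3
    rw [hCh] at ha hb' hc
    obtain ⟨haJ, hca⟩ := mem_filter.1 ha
    obtain ⟨hbJ, hcb⟩ := mem_filter.1 hb'
    obtain ⟨hcJ, hcc⟩ := mem_filter.1 hc
    have hG : G = ∅ := by
      by_contra hG
      obtain ⟨k, hk⟩ := nonempty_iff_ne_empty.2 hG
      have pick : ∀ {g : Fin m}, g ∈ J → IsChord I J g → ∃ s : Fin 4, 2 ≤ s.val ∧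
          (I.vars g s = I.vars k 2 ∨ I.vars g s = I.vars k 3) := by
        intro g hg hcg
        rcases meets_of_chord I J G C hstruct hg hcg hk with h | h
        · exact ⟨2, by decide, by rcases (mem_andPair_iff I k _).1 h with e | e <;> [exact Or.inl e.symm; exact Or.inr e.symm]⟩
        · exact ⟨3, by decide, by rcases (mem_andPair_iff I k _).1 h with e | e <;> [exact Or.inl e.symm; exact Or.inr e.symm]⟩
      obtain ⟨sa, hsa, ea⟩ := pick haJ hca
      obtain ⟨sb, hsb, eb⟩ := pick hbJ hcb
      obtain ⟨sc, hsc, ec⟩ := pick hcJ hcc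
      have dab : I.vars a sa ≠ I.vars b' sb := fun h => hP haJ hca sa hsa b' hbJ (Ne.symm hab) (h ▸ vars_mem_varSet I b' sb)
      have dac : I.vars a sa ≠ I.vars c sc := fun h => hP haJ hca sa hsa c hcJ (Ne.symm hac) (h ▸ vars_mem_varSet I c sc)
      have dbc : I.vars b' sb ≠ I.vars c sc := fun h => hP hbJ hcb sb hsb c hcJ (Ne.symm hbc) (h ▸ vars_mem_varSet I c sc)
      rcases ea with ea | ea <;> rcases eb with eb | eb <;> rcases ec with ec | ec
      · exact dab (ea.trans eb.symm)
      · exact dab (ea.trans eb.symm)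
      · exact dac (ea.trans ec.symm)
      · exact dbc (eb.trans ec.symm)
      · exact dbc (eb.trans ec.symm)
      · exact dac (ea.trans ec.symm)
      · exact dab (ea.trans eb.symm)
      · exact dab (ea.trans eb.symm)
    have hCe : C = ∅ := by
      by_contra hC
      obtain ⟨v, hv⟩ := nonempty_iff_ne_empty.2 hC
      have hnbe : ∀ p : Fin n, nbG I G p = ∅ := fun p => by
        refine eq_empty_of_forall_notMem fun x hx => ?_
        obtain ⟨k, hk, -, -⟩ := mem_nbG.1 hx
        rw [hG] at hk
        exact notMem_empty k hk
      have inP : ∀ {g : Fin m}, g ∈ J → IsChord I J g → v = I.vars g 2 ∨ v = I.vars g 3 := by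
        intro g hg hcg
        by_contra hno
        push Not at hno
        rcases mem_C_imp I J G C hstruct hg hcg hv hno.1 hno.2 with h | h <;>
        · rw [hnbe] at h; exact notMem_empty v h
      rcases inP haJ hca with e | e <;> rcases inP hbJ hcb with e' | e'
      · exact hP haJ hca 2 (by decide) b' hbJ (Ne.symm hab) ((e.symm.trans e') ▸ vars_mem_varSet I b' 2)
      · exact hP haJ hca 2 (by decide) b' hbJ (Ne.symm hab) ((e.symm.trans e') ▸ vars_mem_varSet I b' 3)
      · exact hP haJ hca 3 (by decide) b' hbJ (Ne.symm hab) ((e.symm.trans e') ▸ vars_mem_varSet I b' 2)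
      · exact hP haJ hca 3 (by decide) b' hbJ (Ne.symm hab) ((e.symm.trans e') ▸ vars_mem_varSet I b' 3)
    rcases (gval_nonconst_iff I hnd hdist).1 hnc with h | h
    · exact h hCe
    · exact h hG
  -- at most two chords
  push Not at h3
  have hF₀c : F₀.card = 0 := by omega
  have hF₀e : ∀ j ∈ J, ¬ IsChord I J j → I.vars j 2 ∈ bdry I J ∨ I.vars j 3 ∈ bdry I J := by
    intro j hj hcj
    by_contra hno
    have : j ∈ F₀ := by rw [hF₀]; exact mem_filter.2 ⟨hj, hcj, hno⟩
    rw [card_eq_zero.1 hF₀c] at this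
    exact notMem_empty j this
  by_cases hF₁e : F₁ = ∅
  · -- every output is a chord and `#J ≤ 2`
    have hall : ∀ j ∈ J, IsChord I J j := by
      intro j hj
      by_contra hcj
      have : j ∈ F₁ := by rw [hF₁]; exact mem_filter.2 ⟨hj, hcj, hF₀e j hj hcj⟩
      rw [hF₁e] at this
      exact notMem_empty j this
    have hJ2 : J.card ≤ 2 := by
      have : J = Ch := by
        rw [hCh]; ext j; rw [mem_filter]; exact ⟨fun hj => ⟨hj, hall j hj⟩, fun h => h.1⟩
      rw [this]; exact h3
    obtain ⟨j₁, hj₁, hne₁, hm₁⟩ := exists_other_reader I hg₀ (vars_mem_varSet I g₀ 0) (hnoX g₀ hg₀ 0 (by decide))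
    obtain ⟨j₂, hj₂, hne₂, hm₂⟩ := exists_other_reader I hg₀ (vars_mem_varSet I g₀ 1) (hnoX g₀ hg₀ 1 (by decide))
    have h12 : j₁ = j₂ := by
      have hc : (J.erase g₀).card ≤ 1 := by rw [card_erase_of_mem hg₀]; omega
      exact card_le_one.1 hc j₁ (mem_erase.2 ⟨hne₁, hj₁⟩) j₂ (mem_erase.2 ⟨hne₂, hj₂⟩)
    subst h12
    have h01 : I.vars g₀ 0 ≠ I.vars g₀ 1 := fun h => absurd (hI.2 g₀ h) (by decide)
    have hsub : ({I.vars g₀ 0, I.vars g₀ 1} : Finset (Fin n)) ⊆ varSet I g₀ ∩ varSet I j₁ := by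
      intro v hv; rw [mem_insert, mem_singleton] at hv; rw [mem_inter]
      rcases hv with rfl | rfl
      exacts [⟨vars_mem_varSet I g₀ 0, hm₁⟩, ⟨vars_mem_varSet I g₀ 1, hm₂⟩]
    have := (card_le_card hsub).trans (hS g₀ j₁ (Ne.symm hne₁))
    rw [card_pair h01] at this
    omega
  · -- a non-chord `f` with one private AND slot; its partner is read by another non-chord `f'`
    obtain ⟨f, hfF⟩ := nonempty_iff_ne_empty.2 hF₁e
    rw [hF₁] at hfF
    obtain ⟨hfJ, hfc, hf23⟩ := mem_filter.1 hfF
    obtain ⟨sa, sd, hsa, hsd, hasd, hla, hld⟩ : ∃ sa sd : Fin 4, 2 ≤ sa.val ∧ 2 ≤ sd.val ∧ sa ≠ sd ∧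
        I.vars f sa ∈ bdry I J ∧ I.vars f sd ∉ bdry I J := by
      rcases hf23 with h2 | h3
      · exact ⟨2, 3, by decide, by decide, by decide, h2, fun h => hfc ⟨h2, h⟩⟩
      · exact ⟨3, 2, by decide, by decide, by decide, h3, fun h => hfc ⟨h, h3⟩⟩
    obtain ⟨f', hf'J, hff', hdm⟩ := exists_other_reader I hfJ (vars_mem_varSet I f sd) hld
    obtain ⟨td, htd, hvd⟩ := and_slot_of_mem_varSet I hT hsd hdm
    have hf'c : ¬ IsChord I J f' := fun hcf => and_slot_not_mem_chord I hT hfJ hf'J hcf hff' sd hsd hdm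
    -- the private slot of `f'` is the other one
    obtain ⟨ta, hta, htad⟩ : ∃ ta : Fin 4, 2 ≤ ta.val ∧ ta ≠ td := by
      have : td = 2 ∨ td = 3 := by fin_cases td <;> simp at htd ⊢
      rcases this with rfl | rfl
      exacts [⟨3, by decide, by decide⟩, ⟨2, by decide, by decide⟩]
    have hla' : I.vars f' ta ∈ bdry I J := by
      rcases hF₀e f' hf'J hf'c with h | h
      · have : ta = 2 ∨ td = 2 := by
          have h1 : ta = 2 ∨ ta = 3 := by fin_cases ta <;> simp at hta ⊢
          have h2 : td = 2 ∨ td = 3 := by fin_cases td <;> simp at htd ⊢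
          rcases h1 with h1 | h1
          · exact Or.inl h1
          · rcases h2 with h2 | h2
            · exact Or.inr h2
            · exact absurd (h1.trans h2.symm) htad
        rcases this with rfl | rfl
        · exact h
        · exact absurd (hvd ▸ h) hld
      · have : ta = 3 ∨ td = 3 := by
          have h1 : ta = 2 ∨ ta = 3 := by fin_cases ta <;> simp at hta ⊢
          have h2 : td = 2 ∨ td = 3 := by fin_cases td <;> simp at htd ⊢
          rcases h1 with h1 | h1
          · rcases h2 with h2 | h2
            · exact absurd (h1.trans h2.symm) htad
            · exact Or.inr h2
          · exact Or.inl h1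
        rcases this with rfl | rfl
        · exact h
        · exact absurd (hvd ▸ h) hld
    -- `F₁ = {f, f'}` and `Ch` has exactly two elements
    have hf'F : f' ∈ F₁ := by rw [hF₁]; exact mem_filter.2 ⟨hf'J, hf'c, hF₀e f' hf'J hf'c⟩
    have hF₁2 : 2 ≤ F₁.card := by
      have hsub : ({f, f'} : Finset (Fin m)) ⊆ F₁ := by
        intro x hx; rw [mem_insert, mem_singleton] at hx
        rcases hx with rfl | rfl
        · rw [hF₁]; exact mem_filter.2 ⟨hfJ, hfc, hf23⟩
        · exact hf'F
      have := card_le_card hsub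
      rw [card_pair (Ne.symm hff')] at this
      exact this
    have hCh2 : Ch.card = 2 := by omega
    obtain ⟨g₁, g₂, hne12, hCh12⟩ := card_eq_two.1 hCh2
    have hg₁ : g₁ ∈ J ∧ IsChord I J g₁ := by
      have : g₁ ∈ Ch := by rw [hCh12]; simp
      rw [hCh] at this; exact mem_filter.1 this
    have hg₂ : g₂ ∈ J ∧ IsChord I J g₂ := by
      have : g₂ ∈ Ch := by rw [hCh12]; simp
      rw [hCh] at this; exact mem_filter.1 this
    have hF₁eq : F₁ = {f, f'} := by
      symm
      apply eq_of_subset_of_card_le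
      · intro x hx; rw [mem_insert, mem_singleton] at hx
        rcases hx with rfl | rfl
        · rw [hF₁]; exact mem_filter.2 ⟨hfJ, hfc, hf23⟩
        · exact hf'F
      · rw [card_pair (Ne.symm hff')]; omega
    have hJ : ∀ j ∈ J, j = g₁ ∨ j = g₂ ∨ j = f ∨ j = f' := by
      intro j hj
      by_cases hcj : IsChord I J j
      · have : j ∈ Ch := by rw [hCh]; exact mem_filter.2 ⟨hj, hcj⟩
        rw [hCh12, mem_insert, mem_singleton] at this
        rcases this with h | h
        exacts [Or.inl h, Or.inr (Or.inl h)]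
      · have : j ∈ F₁ := by rw [hF₁]; exact mem_filter.2 ⟨hj, hcj, hF₀e j hj hcj⟩
        rw [hF₁eq, mem_insert, mem_singleton] at this
        rcases this with h | h
        exacts [Or.inr (Or.inr (Or.inl h)), Or.inr (Or.inr (Or.inr h))]
    -- the structural hypotheses of the endgame
    have hmeet : ∀ k ∈ G, (I.vars g₁ 2 ∈ andPair I k ∨ I.vars g₁ 3 ∈ andPair I k) ∧
        (I.vars g₂ 2 ∈ andPair I k ∨ I.vars g₂ 3 ∈ andPair I k) := fun k hk =>
      ⟨meets_of_chord I J G C hstruct hg₁.1 hg₁.2 hk, meets_of_chord I J G C hstruct hg₂.1 hg₂.2 hk⟩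
    have hCsub : ∀ v ∈ C, v = I.vars g₁ 2 ∨ v = I.vars g₁ 3 ∨ v = I.vars g₂ 2 ∨ v = I.vars g₂ 3 := by
      intro v hv
      by_cases h2 : v = I.vars g₁ 2
      · exact Or.inl h2
      by_cases h3 : v = I.vars g₁ 3
      · exact Or.inr (Or.inl h3)
      rcases mem_C_imp I J G C hstruct hg₁.1 hg₁.2 hv h2 h3 with h | h
      · exact Or.inr (Or.inr (far_mem I J G C hstruct hg₁.1 hg₁.2 hg₂.1 hg₂.2 hne12 2 (by decide) h))
      · exact Or.inr (Or.inr (far_mem I J G C hstruct hg₁.1 hg₁.2 hg₂.1 hg₂.2 hne12 3 (by decide) h))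
    exact c4 _ _ _ _ hg₁.1 hg₂.1 hg₁.2 hg₂.2 hne12 hfJ hf'J hfc hf'c _ _ _ _ hsa hsd hasd hta htd htad hla hla' hvd.symm hJ
      hmeet hCsub

end Chords

end Summit.PneNP.PneNP.Theorems.PstarGSatChords
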